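/-
Copyright: lit-balaban cell, Phase-2 proof seat p24 (gen 24).  Released under Apache 2.0 license as described in the
file LICENSE.
-/
import Literature.MathematicalPhysics.QuantumFieldTheory.Balaban1983to89.B4Block227
import Literature.MathematicalPhysics.QuantumFieldTheory.Balaban1983to89.B4Eq244L2Unique

/-!
# `Balaban1983to89.B4Ineq227LatticeL2` — [Balaban1983RegularityDecay] (1.8) p. 573 ∕ (2.26)–(2.28) p. 580 AT `A = 0` ON THE
# INFINITE FINE LATTICE `ξℤ^{d+1}`: `⟨φ,(−Δ^ξ + m² + aQ_j^*Q_j)φ⟩ ≥ (min{8,a} + m²)‖φ‖²` on `ℓ²`, and the operator is bounded below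

statement-level skeleton of published theorems with citation tags; proofs where landed; nothing here is a claim about
the Yang–Mills mass gap

CITATION HEADER.  T. Bałaban, *Regularity and decay of lattice Green's functions*, Commun. Math. Phys. **89** (1983)
571–597, doi:10.1007/bf01214744 [Balaban1983RegularityDecay] (cell paper B4; held text
`paper:balaban1983-cmp89-regularity-decay`, journal page = PDF page + 570), p. 573 [PDF 3] (1.8), p. 580 [PDF 10]
(2.26)–(2.28), p. 584 [PDF 14] (2.44); renders `pub-balaban/b2b-balaban-ref1/pages/1983-cmp89-regularity-decay/…-p003-x2.png`,
`…-p010-x2.png`, `…-p014-x2.png` (unit `lit-balaban-p24` gen 24; HOME `run/shared/lean/pub/lit-balaban/`; SKELETON rows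
**B4.Eq1.8**, **B4.Eq2.27** — cells only, both rows proved-headed: the tree has (1.8) ∕ (2.26)–(2.28) for FINITE block unions
`□` (`B4Ineq228OperatorOrder`, `B4TwoScaleForm`, `B4Block227.blockForm_ineq`), for tori (`B4Block227.torus_energy_lower_bound`,
`B4TorusPositivity`) and for regions at regular `A` (`B4Lemma21RegularWindow`, `B4ThmRegionPairEta`); this file is the instance
`Ω = ξℤ^{d+1}`, `A = 0` — the setting of p. 584 «the propagator G_j with free boundary conditions on ξZ^d» and of the
(2.43)–(2.48) chain `B4Green244` … `B4Eq246SolvesEq244`).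

WHAT IS PRINTED.  p. 573: «The operator defining the Green's function (1.6) has a strictly positive lower bound. More
exactly we prove that there exists a positive constant γ₀ such that for ε sufficiently small and for a regular vector field
A, −Δ^η_{A,Ω} + aP_k(A) ≥ γ₀I. (1.8)  The constant γ₀ is independent of the lattice spacing η, as well as of Ω and of A. This
bound justifies the definition (1.6) and explains exponential decay properties.»; p. 580: «□ is a sum of unit cubes Δ and we
have ⟨φ,(−Δ^{η,N}_□ + m_k² + a_kP_k)φ⟩ ≥ Σ_{Δ⊂□}⟨φ,(−Δ^{η,N}_Δ + a_kP_k)φ⟩. (2.26) … ⟨φ,(−Δ^{η,N}_Δ + a_kP_k)φ⟩ ≥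
min{π², a_k}‖φ‖_{L²(Δ)}, (2.27) and from this and (2.26) we get 0 < G_k(□,0) ≤ c₀I, c₀⁻¹ = min{π²,a_k}» (the constant
`π²` is the located slip G-B4-03 of the cell's census, repaired to `8 = inf_s 4s²sin²(π/2s)` in `B4Block227`).

WHAT THIS MODULE PROVES (kernel-checked; theorems only — no definition, no `Prop` fact, 0 `sorry`; axioms standard).  Fine
lattice `ξℤ^{d+1}`, `ξ = 1/n`, `n ≥ 1`; `φ ∈ ℓ²(ℤ^{d+1})` (`Σ_z|φ(z)|² < ∞`); `a ≥ 0`, `m² ≥ 0`; `D = B4Green244.opD n a m²`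
(`= −Δ^ξ + m² + aQ_j^*Q_j`, (2.44)); norms unweighted (`Σ_z|·|²`, the common factor `ξ^{d+1}` of print's `L²` norms dropped on
both sides).
* §2 `sum_blocks_lower_bound` — (2.26)–(2.27) over an ARBITRARY FINITE UNION OF BLOCKS `□ = ⋃_{x∈T}B(x)` of the infinite
  lattice: `min{8,a}·Σ_{x∈T}Σ_{B(x)}|φ|² ≤ n²Σ_μΣ_z|φ(z+e_μ)−φ(z)|² + a·n^{−(d+1)}Σ_x|Σ_{B(x)}φ|²` (`B4Block227.block227` block by
  block; the in-block Neumann bonds of distinct blocks are distinct lattice bonds).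
* §3 `finset_sum_lower_bound`, **`form_lower_bound_l2`** — exhaustion: `(min{8,a} + m²)·Σ_z|φ(z)|² ≤ n²Σ_μΣ_z|∇_μφ|² +
  m²Σ_z|φ|² + a·n^{−(d+1)}Σ_x|Σ_{B(x)}φ|²` for every `φ ∈ ℓ²(ξℤ^{d+1})`.
* §4 **`energy_lower_bound_l2`** — **(1.8) for `Ω = ξℤ^{d+1}`, `A = 0`**: `Re⟨φ, Dφ⟩ ≥ (min{8,a} + m²)‖φ‖²_{ℓ²}` (the pairing
  is the energy by `B4Eq244L2Unique.tsum_conj_mul_opD`).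
* §5 `summable_normSq_opD` (`D` maps `ℓ²` into `ℓ²`), **`norm_opD_ge`**: `‖Dφ‖_{ℓ²} ≥ (min{8,a} + m²)‖φ‖_{ℓ²}` (Cauchy–Schwarz),
  and `opD_injective_l2_of_pos` (injectivity on `ℓ²` with modulus, any `d+1 ≥ 1`, whenever `min{8,a} + m² > 0`).
The `ℓ²` bound «`0 < G_j ≤ c₀I`» for the propagator `G_j = G246` of `B4Eq246SolvesEq244` ((2.28) for `Ω = ξℤ^{d+1}`) follows
from §4 once `G_jf ∈ ℓ²` is available (`B4Eq246SquareSummable`, filed); it is left to that file's successor to keep this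
module's imports built.

DICTIONARY / HONEST SCOPE.  (i) `A = 0`, scalar fields, infinite lattice; constants: print's `γ₀` ∕ `c₀⁻¹ = min{π², a_k}` ↦
`min{8,a} + m²` (repaired constant; the mass `m² ≥ 0` only helps); dimension written `d+1 ≥ 1` (the block machinery of
`B4Block227`).  (ii) No statement about regular `A ≠ 0`, regions `Ω ≠ ξℤ^{d+1}`, or surjectivity of `D` on `ℓ²` (existence of
`D⁻¹f` for `f ∈ ℓ¹` is `B4Eq246SolvesEq244.opD_G246`; for general `f ∈ ℓ²` it is not treated).  (iii) Value = kernel certificate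
of print's lower bound in the one setting the (2.43)–(2.48) files use; cells of proved-headed rows; NOT summit progress.
-/

namespace Literature.MathematicalPhysics.QuantumFieldTheory.Balaban1983to89.B4Ineq227LatticeL2

open Complex Finset
open Literature.MathematicalPhysics.QuantumFieldTheory.Balaban1983to89.Beta.CoordCubePoincare (stepUp)
open Literature.MathematicalPhysics.QuantumFieldTheory.Balaban1983to89.B4Green244
open Literature.MathematicalPhysics.QuantumFieldTheory.Balaban1983to89.B4Eq245Aliasing (blockEquiv)
open Literature.MathematicalPhysics.QuantumFieldTheory.Balaban1983to89.B4Eq244L2Unique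
open Literature.MathematicalPhysics.QuantumFieldTheory.Balaban1983to89.B4Block227
open scoped Real ComplexConjugate

noncomputable section

variable {d : ℕ}

/-! ### §1 `ℓ²` bookkeeping over the blocks of the fine lattice -/

/-- a finite union of blocks carries at most the whole-lattice sum of a non-negative summable function:
`Σ_{x∈T} Σ_{z∈B(x)} G(z) ≤ Σ_{z∈ℤ^{d+1}} G(z)`. [folklore] -/
private theorem sum_blocks_le_tsum (n : ℕ) [NeZero n] {G : (Fin (d + 1) → ℤ) → ℝ} (hG0 : ∀ z, 0 ≤ G z)
    (hG : Summable G) (T : Finset (Fin (d + 1) → ℤ)) :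
    ∑ x ∈ T, ∑ j : Fin (d + 1) → Fin n, G (finePt n x j) ≤ ∑' z, G z := by
  have h1 : ∑ x ∈ T, ∑ j : Fin (d + 1) → Fin n, G (finePt n x j)
      = ∑ p ∈ T ×ˢ (Finset.univ : Finset (Fin (d + 1) → Fin n)), G (blockEquiv n p) := by
    rw [Finset.sum_product]
    rfl
  rw [h1, ← Finset.sum_image fun p _ q _ h => (blockEquiv n).injective h]
  exact (hG.sum_le_tsum _ fun z _ => hG0 z)

/-- a finite set of fine points lies in the blocks of its block labels: `Σ_{z∈u} G(z) ≤ Σ_{x∈⌊u/n⌋} Σ_{z∈B(x)} G(z)` for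
`G ≥ 0`. [folklore] -/
private theorem sum_le_sum_blocks (n : ℕ) [NeZero n] {G : (Fin (d + 1) → ℤ) → ℝ} (hG0 : ∀ z, 0 ≤ G z)
    (u : Finset (Fin (d + 1) → ℤ)) :
    ∑ z ∈ u, G z ≤ ∑ x ∈ u.image (coarse n), ∑ j : Fin (d + 1) → Fin n, G (finePt n x j) := by
  classical
  have h1 : ∑ x ∈ u.image (coarse n), ∑ j : Fin (d + 1) → Fin n, G (finePt n x j)
      = ∑ z ∈ (u.image (coarse n) ×ˢ (Finset.univ : Finset (Fin (d + 1) → Fin n))).image (blockEquiv n), G z := by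
    rw [Finset.sum_image fun p _ q _ h => (blockEquiv n).injective h, Finset.sum_product]
    rfl
  rw [h1]
  refine Finset.sum_le_sum_of_subset_of_nonneg (fun z hz => ?_) fun z _ _ => hG0 z
  refine Finset.mem_image.mpr ⟨(coarse n z, offset n z), ?_, finePt_coarse_offset n z⟩
  exact Finset.mem_product.mpr ⟨Finset.mem_image_of_mem _ hz, Finset.mem_univ _⟩

/-- the block sums of an `ℓ²` field are square-summable: `|Σ_{B(x)}φ|² ≤ n^{d+1}Σ_{B(x)}|φ|²` (Cauchy–Schwarz) and the
blocks partition the lattice. [folklore] -/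
private theorem summable_normSq_blockSum' (n : ℕ) [NeZero n] {φ : (Fin (d + 1) → ℤ) → ℂ}
    (hφ : Summable fun z => ‖φ z‖ ^ 2) : Summable fun x => ‖blockSum n φ x‖ ^ 2 := by
  have h1 : Summable fun xj : (Fin (d + 1) → ℤ) × (Fin (d + 1) → Fin n) => ‖φ (finePt n xj.1 xj.2)‖ ^ 2 := by
    have := (blockEquiv n).summable_iff.mpr hφ
    have h3 : (fun z => ‖φ z‖ ^ 2) ∘ blockEquiv n
        = fun xj : (Fin (d + 1) → ℤ) × (Fin (d + 1) → Fin n) => ‖φ (finePt n xj.1 xj.2)‖ ^ 2 := by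
      funext xj
      simp only [Function.comp, blockEquiv, Equiv.coe_fn_mk]
    rw [h3] at this
    exact this
  have h2 : Summable fun x : Fin (d + 1) → ℤ => ∑ j : Fin (d + 1) → Fin n, ‖φ (finePt n x j)‖ ^ 2 := by
    have := h1.prod
    simpa [tsum_fintype] using this
  refine Summable.of_nonneg_of_le (fun x => sq_nonneg _) (fun x => ?_) (h2.mul_left ((n : ℝ) ^ (d + 1)))
  -- Cauchy–Schwarz on the block
  have hcs := Finset.sum_mul_sq_le_sq_mul_sq (Finset.univ : Finset (Fin (d + 1) → Fin n))
    (fun j => ‖φ (finePt n x j)‖) (fun _ => (1 : ℝ))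
  have hcard : ∑ _j : Fin (d + 1) → Fin n, (1 : ℝ) ^ 2 = (n : ℝ) ^ (d + 1) := by simp
  rw [hcard] at hcs
  have hn : ‖blockSum n φ x‖ ≤ ∑ j : Fin (d + 1) → Fin n, ‖φ (finePt n x j)‖ * 1 := by
    simpa [blockSum] using norm_sum_le (Finset.univ : Finset (Fin (d + 1) → Fin n)) (fun j => φ (finePt n x j))
  calc ‖blockSum n φ x‖ ^ 2 ≤ (∑ j : Fin (d + 1) → Fin n, ‖φ (finePt n x j)‖ * 1) ^ 2 :=
        pow_le_pow_left₀ (norm_nonneg _) hn 2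
    _ ≤ (∑ j : Fin (d + 1) → Fin n, ‖φ (finePt n x j)‖ ^ 2) * (n : ℝ) ^ (d + 1) := hcs
    _ = (n : ℝ) ^ (d + 1) * ∑ j : Fin (d + 1) → Fin n, ‖φ (finePt n x j)‖ ^ 2 := mul_comm _ _

/-! ### §2 (2.26)–(2.27) summed over a finite set of blocks of `ξℤ^{d+1}` -/

/-- **(2.26)–(2.27) OVER A FINITE UNION OF BLOCKS OF THE INFINITE LATTICE**: for `φ ∈ ℓ²(ℤ^{d+1})`, `a ≥ 0`, block side
`n = k+1` and every finite set `T` of block labels,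
`min{8,a}·Σ_{x∈T}Σ_{z∈B(x)}|φ(z)|² ≤ n²Σ_μΣ_{z∈ℤ^{d+1}}|φ(z+e_μ) − φ(z)|² + a·n^{−(d+1)}Σ_{x∈ℤ^{d+1}}|Σ_{z∈B(x)}φ(z)|²` —
print's «□ is a sum of unit cubes Δ … (2.26) … (2.27)» with `□ = ⋃_{x∈T}B(x)`, the in-block Neumann bonds of distinct blocks
being distinct bonds of the lattice (so their energy is at most the whole nearest-neighbour energy) and the block term
non-negative. [cite: Balaban1983RegularityDecay, (2.26)–(2.27) p.580; repaired constant min{8,a} of `B4Block227`] -/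
theorem sum_blocks_lower_bound (k : ℕ) {a : ℝ} (ha : 0 ≤ a) {φ : (Fin (d + 1) → ℤ) → ℂ}
    (hφ : Summable fun z => ‖φ z‖ ^ 2) (T : Finset (Fin (d + 1) → ℤ)) :
    min 8 a * ∑ x ∈ T, ∑ j : Fin (d + 1) → Fin (k + 1), ‖φ (finePt (k + 1) x j)‖ ^ 2
      ≤ ((k : ℝ) + 1) ^ 2 * ∑ μ : Fin (d + 1), ∑' z, ‖φ (z + e μ) - φ z‖ ^ 2
        + a * (((k : ℝ) + 1) ^ (d + 1))⁻¹ * ∑' x, ‖blockSum (k + 1) φ x‖ ^ 2 := by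
  -- (2.27) block by block (`B4Block227.block227`), summed over `T`
  have hblock : ∀ x : Fin (d + 1) → ℤ,
      min 8 a * ∑ j : Fin (d + 1) → Fin (k + 1), ‖φ (finePt (k + 1) x j)‖ ^ 2
        ≤ ((k : ℝ) + 1) ^ 2 * ∑ μ : Fin (d + 1),
              ∑ j ∈ Finset.univ.filter (fun j : Fin (d + 1) → Fin (k + 1) => j μ ≠ Fin.last k),
                ‖φ (finePt (k + 1) x (stepUp j μ)) - φ (finePt (k + 1) x j)‖ ^ 2
          + a * (((k : ℝ) + 1) ^ (d + 1))⁻¹ * ‖∑ j : Fin (d + 1) → Fin (k + 1), φ (finePt (k + 1) x j)‖ ^ 2 :=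
    fun x => block227 k (d + 1) a (fun j => φ (finePt (k + 1) x j))
  have hsum := Finset.sum_le_sum fun x (_ : x ∈ T) => hblock x
  rw [← Finset.mul_sum, Finset.sum_add_distrib, ← Finset.mul_sum, ← Finset.mul_sum] at hsum
  -- (2.26): the in-block bonds, rewritten as lattice bonds, are dominated by the whole-lattice gradient energy
  have hgrad : ∑ x ∈ T, ∑ μ : Fin (d + 1),
        ∑ j ∈ Finset.univ.filter (fun j : Fin (d + 1) → Fin (k + 1) => j μ ≠ Fin.last k),
          ‖φ (finePt (k + 1) x (stepUp j μ)) - φ (finePt (k + 1) x j)‖ ^ 2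
      ≤ ∑ μ : Fin (d + 1), ∑' z, ‖φ (z + e μ) - φ z‖ ^ 2 := by
    rw [Finset.sum_comm]
    refine Finset.sum_le_sum fun μ _ => ?_
    calc ∑ x ∈ T, ∑ j ∈ Finset.univ.filter (fun j : Fin (d + 1) → Fin (k + 1) => j μ ≠ Fin.last k),
            ‖φ (finePt (k + 1) x (stepUp j μ)) - φ (finePt (k + 1) x j)‖ ^ 2
        = ∑ x ∈ T, ∑ j ∈ Finset.univ.filter (fun j : Fin (d + 1) → Fin (k + 1) => j μ ≠ Fin.last k),
            ‖φ (finePt (k + 1) x j + e μ) - φ (finePt (k + 1) x j)‖ ^ 2 :=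
          Finset.sum_congr rfl fun x _ => Finset.sum_congr rfl fun j hj => by
            rw [finePt_stepUp k x j μ (Finset.mem_filter.mp hj).2]
      _ ≤ ∑ x ∈ T, ∑ j : Fin (d + 1) → Fin (k + 1), ‖φ (finePt (k + 1) x j + e μ) - φ (finePt (k + 1) x j)‖ ^ 2 :=
          Finset.sum_le_sum fun x _ =>
            Finset.sum_le_sum_of_subset_of_nonneg (Finset.filter_subset _ _) fun j _ _ => sq_nonneg _
      _ ≤ ∑' z, ‖φ (z + e μ) - φ z‖ ^ 2 :=
          sum_blocks_le_tsum (k + 1) (G := fun z => ‖φ (z + e μ) - φ z‖ ^ 2) (fun z => sq_nonneg _)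
            (summable_normSq_diff hφ μ) T
  -- the block term over `T` is at most the whole-lattice block term
  have hbl : ∑ x ∈ T, ‖∑ j : Fin (d + 1) → Fin (k + 1), φ (finePt (k + 1) x j)‖ ^ 2
      ≤ ∑' x, ‖blockSum (k + 1) φ x‖ ^ 2 :=
    (summable_normSq_blockSum' (k + 1) hφ).sum_le_tsum T fun x _ => sq_nonneg _
  have hk2 : (0 : ℝ) ≤ ((k : ℝ) + 1) ^ 2 := by positivity
  have hac : (0 : ℝ) ≤ a * (((k : ℝ) + 1) ^ (d + 1))⁻¹ := by positivity
  calc min 8 a * ∑ x ∈ T, ∑ j : Fin (d + 1) → Fin (k + 1), ‖φ (finePt (k + 1) x j)‖ ^ 2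
      ≤ ((k : ℝ) + 1) ^ 2 * ∑ x ∈ T, ∑ μ : Fin (d + 1),
            ∑ j ∈ Finset.univ.filter (fun j : Fin (d + 1) → Fin (k + 1) => j μ ≠ Fin.last k),
              ‖φ (finePt (k + 1) x (stepUp j μ)) - φ (finePt (k + 1) x j)‖ ^ 2
          + a * (((k : ℝ) + 1) ^ (d + 1))⁻¹
            * ∑ x ∈ T, ‖∑ j : Fin (d + 1) → Fin (k + 1), φ (finePt (k + 1) x j)‖ ^ 2 := hsum
    _ ≤ ((k : ℝ) + 1) ^ 2 * ∑ μ : Fin (d + 1), ∑' z, ‖φ (z + e μ) - φ z‖ ^ 2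
          + a * (((k : ℝ) + 1) ^ (d + 1))⁻¹ * ∑' x, ‖blockSum (k + 1) φ x‖ ^ 2 :=
        add_le_add (mul_le_mul_of_nonneg_left hgrad hk2) (mul_le_mul_of_nonneg_left hbl hac)

/-! ### §3 Exhaustion: the quadratic-form bound on `ℓ²(ξℤ^{d+1})` -/

/-- the whole-lattice energy bounds the mass of every finite set of fine points: for finite `u ⊂ ℤ^{d+1}`,
`(min{8,a} + m²)·Σ_{z∈u}|φ(z)|² ≤ n²Σ_μ‖∇_μφ‖²_{ℓ²} + m²‖φ‖²_{ℓ²} + a·n^{−(d+1)}Σ_x|Σ_{B(x)}φ|²` (`a, m² ≥ 0`).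
[cite: Balaban1983RegularityDecay, (2.26)–(2.27) p.580; repaired constant; dictionary (Ω = ξℤ^{d+1}, A = 0)] -/
theorem finset_sum_lower_bound (k : ℕ) {a m2 : ℝ} (ha : 0 ≤ a) (hm : 0 ≤ m2) {φ : (Fin (d + 1) → ℤ) → ℂ}
    (hφ : Summable fun z => ‖φ z‖ ^ 2) (u : Finset (Fin (d + 1) → ℤ)) :
    (min 8 a + m2) * ∑ z ∈ u, ‖φ z‖ ^ 2
      ≤ ((k : ℝ) + 1) ^ 2 * ∑ μ : Fin (d + 1), ∑' z, ‖φ (z + e μ) - φ z‖ ^ 2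
        + m2 * ∑' z, ‖φ z‖ ^ 2
        + a * (((k : ℝ) + 1) ^ (d + 1))⁻¹ * ∑' x, ‖blockSum (k + 1) φ x‖ ^ 2 := by
  classical
  set T := u.image (coarse (k + 1)) with hT
  set S : ℝ := ∑ x ∈ T, ∑ j : Fin (d + 1) → Fin (k + 1), ‖φ (finePt (k + 1) x j)‖ ^ 2 with hS
  have h1 : ∑ z ∈ u, ‖φ z‖ ^ 2 ≤ S :=
    sum_le_sum_blocks (k + 1) (G := fun z => ‖φ z‖ ^ 2) (fun z => sq_nonneg _) u
  have h2 : S ≤ ∑' z, ‖φ z‖ ^ 2 :=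
    sum_blocks_le_tsum (k + 1) (G := fun z => ‖φ z‖ ^ 2) (fun z => sq_nonneg _) hφ T
  have h3 := sum_blocks_lower_bound k ha hφ T
  have hmin : (0 : ℝ) ≤ min 8 a := le_min (by norm_num) ha
  have h4 := mul_le_mul_of_nonneg_left h1 (add_nonneg hmin hm)
  have h5 := mul_le_mul_of_nonneg_left h2 hm
  rw [hS] at h4
  calc (min 8 a + m2) * ∑ z ∈ u, ‖φ z‖ ^ 2
      ≤ (min 8 a + m2) * S := by rw [hS]; exact h4
    _ = min 8 a * S + m2 * S := by ring
    _ ≤ _ := by rw [hS]; linarith [h3, h5]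

/-- **(1.8) ∕ (2.27) ON THE INFINITE FINE LATTICE, AS REAL QUADRATIC FORMS**: for every square-summable `φ` on `ξℤ^{d+1}`
(`ξ = 1/n`, `n ≥ 1`), `a ≥ 0`, `m² ≥ 0`:
`(min{8,a} + m²)·Σ_z|φ(z)|² ≤ n²Σ_μΣ_z|φ(z+e_μ) − φ(z)|² + m²Σ_z|φ(z)|² + a·n^{−(d+1)}Σ_x|Σ_{z∈B(x)}φ(z)|²` — the right-hand
side is `⟨φ,(−Δ^ξ + m² + aQ_j^*Q_j)φ⟩` (`B4Eq244L2Unique.tsum_conj_mul_opD`).  Print: «−Δ^η_{A,Ω} + aP_k(A) ≥ γ₀I (1.8) … This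
bound justifies the definition (1.6)», here for `Ω = ηℤ^{d+1}`, `A = 0`, `γ₀ = min{8,a} + m²`.
[cite: Balaban1983RegularityDecay, (1.8) p.573, (2.26)–(2.27) p.580; repaired constant; dictionary (Ω = ξℤ^{d+1}, A = 0)] -/
theorem form_lower_bound_l2 (n : ℕ) [NeZero n] {a m2 : ℝ} (ha : 0 ≤ a) (hm : 0 ≤ m2) {φ : (Fin (d + 1) → ℤ) → ℂ}
    (hφ : Summable fun z => ‖φ z‖ ^ 2) :
    (min 8 a + m2) * ∑' z, ‖φ z‖ ^ 2
      ≤ (n : ℝ) ^ 2 * ∑ μ : Fin (d + 1), ∑' z, ‖φ (z + e μ) - φ z‖ ^ 2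
        + m2 * ∑' z, ‖φ z‖ ^ 2
        + a * ((n : ℝ) ^ (d + 1))⁻¹ * ∑' x, ‖blockSum n φ x‖ ^ 2 := by
  obtain ⟨k, rfl⟩ : ∃ k, n = k + 1 :=
    ⟨n - 1, (Nat.succ_pred_eq_of_pos (Nat.pos_of_ne_zero (NeZero.ne n))).symm⟩
  have hmin : (0 : ℝ) ≤ min 8 a := le_min (by norm_num) ha
  rw [← tsum_mul_left]
  push_cast
  refine Real.tsum_le_of_sum_le (fun z => mul_nonneg (add_nonneg hmin hm) (sq_nonneg _)) fun u => ?_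
  rw [← Finset.mul_sum]
  exact finset_sum_lower_bound k ha hm hφ u

/-! ### §4 (1.8) at `A = 0` on `ξℤ^{d+1}`: the operator inequality `⟨φ, Dφ⟩ ≥ γ₀‖φ‖²` -/

/-- **(1.8) FOR THE FREE OPERATOR ON THE INFINITE LATTICE**: `Re⟨φ,(−Δ^ξ + m² + aQ_j^*Q_j)φ⟩ ≥ (min{8,a} + m²)‖φ‖²_{ℓ²}` for
every `φ ∈ ℓ²(ξℤ^{d+1})`, `a ≥ 0`, `m² ≥ 0` (the pairing is in fact real and equal to the energy of
`form_lower_bound_l2`). [cite: Balaban1983RegularityDecay, (1.8) p.573, (2.27) p.580; repaired constant; dictionary (Ω = ξℤ^{d+1}, A = 0)] -/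
theorem energy_lower_bound_l2 (n : ℕ) [NeZero n] {a m2 : ℝ} (ha : 0 ≤ a) (hm : 0 ≤ m2) {φ : (Fin (d + 1) → ℤ) → ℂ}
    (hφ : Summable fun z => ‖φ z‖ ^ 2) :
    (min 8 a + m2) * ∑' z, ‖φ z‖ ^ 2 ≤ (∑' z, conj (φ z) * opD n a m2 φ z).re := by
  rw [tsum_conj_mul_opD n a m2 hφ]
  have h1 : ∀ μ : Fin (d + 1), ∑' z, ((‖φ (z + e μ) - φ z‖ ^ 2 : ℝ) : ℂ) = ((∑' z, ‖φ (z + e μ) - φ z‖ ^ 2 : ℝ) : ℂ) :=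
    fun μ => (Complex.ofReal_tsum _).symm
  have h2 : ∑' z, ((‖φ z‖ ^ 2 : ℝ) : ℂ) = ((∑' z, ‖φ z‖ ^ 2 : ℝ) : ℂ) := (Complex.ofReal_tsum _).symm
  have h3 : ∑' x, ((‖blockSum n φ x‖ ^ 2 : ℝ) : ℂ) = ((∑' x, ‖blockSum n φ x‖ ^ 2 : ℝ) : ℂ) :=
    (Complex.ofReal_tsum _).symm
  simp_rw [h1]
  rw [h2, h3]
  have h4 : ((n : ℂ) ^ 2 * ∑ μ : Fin (d + 1), ((∑' z, ‖φ (z + e μ) - φ z‖ ^ 2 : ℝ) : ℂ)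
        + (m2 : ℂ) * ((∑' z, ‖φ z‖ ^ 2 : ℝ) : ℂ)
        + (a : ℂ) * (((n : ℂ) ^ (d + 1))⁻¹ * ((∑' x, ‖blockSum n φ x‖ ^ 2 : ℝ) : ℂ)))
      = (((n : ℝ) ^ 2 * ∑ μ : Fin (d + 1), ∑' z, ‖φ (z + e μ) - φ z‖ ^ 2
          + m2 * ∑' z, ‖φ z‖ ^ 2
          + a * ((n : ℝ) ^ (d + 1))⁻¹ * ∑' x, ‖blockSum n φ x‖ ^ 2 : ℝ) : ℂ) := by
    push_cast; ring
  rw [h4, Complex.ofReal_re]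
  exact form_lower_bound_l2 n ha hm hφ

/-! ### §5 `‖Dφ‖_{ℓ²} ≥ γ₀‖φ‖_{ℓ²}`: the operator of (2.44) is bounded below on `ℓ²(ξℤ^{d+1})` -/

/-- Cauchy–Schwarz for the `ℓ²` pairing: `Re Σ_z φ̄(z)ψ(z) ≤ ‖φ‖_{ℓ²}‖ψ‖_{ℓ²}`. [folklore] -/
private theorem re_tsum_conj_mul_le {φ ψ : (Fin (d + 1) → ℤ) → ℂ} (hφ : Summable fun z => ‖φ z‖ ^ 2)
    (hψ : Summable fun z => ‖ψ z‖ ^ 2) :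
    (∑' z, conj (φ z) * ψ z).re ≤ Real.sqrt (∑' z, ‖φ z‖ ^ 2) * Real.sqrt (∑' z, ‖ψ z‖ ^ 2) := by
  -- termwise `|φ̄ψ| = |φ||ψ|`, summable, and Hölder with exponents (2,2)
  have hH := Real.inner_le_Lp_mul_Lq_tsum_of_nonneg Real.HolderConjugate.two_two (fun z => norm_nonneg (φ z))
    (fun z => norm_nonneg (ψ z)) (by simpa [Real.rpow_two] using hφ) (by simpa [Real.rpow_two] using hψ)
  have hS := Real.summable_mul_of_Lp_Lq_of_nonneg Real.HolderConjugate.two_two (fun z => norm_nonneg (φ z))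
    (fun z => norm_nonneg (ψ z)) (by simpa [Real.rpow_two] using hφ) (by simpa [Real.rpow_two] using hψ)
  simp only [Real.rpow_two] at hH
  have hsq : ∀ t : ℝ, t ^ (1 / (2 : ℝ)) = Real.sqrt t := fun t => by rw [Real.sqrt_eq_rpow]
  rw [hsq, hsq] at hH
  have hn : Summable fun z => ‖conj (φ z) * ψ z‖ := by
    refine hS.congr fun z => ?_
    rw [norm_mul, Complex.norm_conj]
  calc (∑' z, conj (φ z) * ψ z).re ≤ ‖∑' z, conj (φ z) * ψ z‖ := Complex.re_le_norm _
    _ ≤ ∑' z, ‖conj (φ z) * ψ z‖ := norm_tsum_le_tsum_norm hn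
    _ = ∑' z, ‖φ z‖ * ‖ψ z‖ := tsum_congr fun z => by rw [norm_mul, Complex.norm_conj]
    _ ≤ Real.sqrt (∑' z, ‖φ z‖ ^ 2) * Real.sqrt (∑' z, ‖ψ z‖ ^ 2) := hH

/-- `x⁰ ↦ nx⁰ + τ` is injective. [folklore] -/
private theorem finePt_injective_left (n : ℕ) [NeZero n] (τ : Fin (d + 1) → Fin n) :
    Function.Injective fun y : Fin (d + 1) → ℤ => finePt n y τ := by
  intro y y' h
  have := congrArg (coarse n) h
  simpa only [coarse_finePt] using this

/-- a summable non-negative function of the block label is summable over the fine lattice (each value repeated `n^{d+1}`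
times). [folklore] -/
private theorem summable_comp_coarse (n : ℕ) [NeZero n] {g : (Fin (d + 1) → ℤ) → ℝ} (hg0 : ∀ y, 0 ≤ g y)
    (hg : Summable g) : Summable fun z => g (coarse n z) := by
  rw [← (blockEquiv n).summable_iff]
  have h3 : (fun z => g (coarse n z)) ∘ blockEquiv n = fun yτ : (Fin (d + 1) → ℤ) × (Fin (d + 1) → Fin n) => g yτ.1 := by
    funext yτ
    simp only [Function.comp, blockEquiv, Equiv.coe_fn_mk, coarse_finePt]
  rw [h3]
  refine (summable_prod_of_nonneg (fun yτ => hg0 _)).mpr ⟨fun y => (hasSum_fintype _).summable, ?_⟩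
  simp_rw [tsum_fintype, Finset.sum_const, Finset.card_univ, nsmul_eq_mul]
  exact hg.mul_left _

/-- the operator of (2.44) maps `ℓ²(ξℤ^{d+1})` into itself (finite stencil, Cauchy–Schwarz).
[cite: Balaban1983RegularityDecay, (2.44) p.584] -/
theorem summable_normSq_opD (n : ℕ) [NeZero n] (a m2 : ℝ) {φ : (Fin (d + 1) → ℤ) → ℂ}
    (hφ : Summable fun z => ‖φ z‖ ^ 2) : Summable fun z => ‖opD n a m2 φ z‖ ^ 2 := by
  have hst : ∀ i : Idx (d + 1) n, Summable fun z => ‖φ (stp n z i)‖ ^ 2 := by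
    intro i
    rcases i with _ | μ | μ | τ
    · exact hφ
    · show Summable ((fun z => ‖φ z‖ ^ 2) ∘ fun z => z + e μ)
      exact hφ.comp_injective (add_left_injective (e μ))
    · show Summable ((fun z => ‖φ z‖ ^ 2) ∘ fun z => z - e μ)
      exact hφ.comp_injective sub_left_injective
    · show Summable fun z => ‖φ (finePt n (coarse n z) τ)‖ ^ 2
      have h1 : Summable fun y : Fin (d + 1) → ℤ => ‖φ (finePt n y τ)‖ ^ 2 := by
        show Summable ((fun z => ‖φ z‖ ^ 2) ∘ fun y => finePt n y τ)
        exact hφ.comp_injective (finePt_injective_left n τ)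
      exact summable_comp_coarse n (g := fun y => ‖φ (finePt n y τ)‖ ^ 2) (fun y => sq_nonneg _) h1
  -- Cauchy–Schwarz on the finite stencil: `|Dφ(z)|² ≤ (Σ_i |c_i|²)(Σ_i |φ(z_i)|²)`
  set C : ℝ := ∑ i : Idx (d + 1) n, ‖stc (d + 1) n a m2 i‖ ^ 2 with hC
  have hmaj : Summable fun z => (∑ i : Idx (d + 1) n, ‖φ (stp n z i)‖ ^ 2) * C :=
    (summable_sum fun i _ => hst i).mul_right C
  refine Summable.of_nonneg_of_le (fun z => sq_nonneg _) (fun z => ?_) hmaj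
  rw [opD_eq_stencil]
  have h1 : ‖∑ i : Idx (d + 1) n, stc (d + 1) n a m2 i * φ (stp n z i)‖
      ≤ ∑ i : Idx (d + 1) n, ‖φ (stp n z i)‖ * ‖stc (d + 1) n a m2 i‖ :=
    (norm_sum_le _ _).trans (le_of_eq (Finset.sum_congr rfl fun i _ => by rw [norm_mul, mul_comm]))
  have h2 := Finset.sum_mul_sq_le_sq_mul_sq (Finset.univ : Finset (Idx (d + 1) n))
    (fun i => ‖φ (stp n z i)‖) (fun i => ‖stc (d + 1) n a m2 i‖)
  have h0 : 0 ≤ ∑ i : Idx (d + 1) n, ‖φ (stp n z i)‖ * ‖stc (d + 1) n a m2 i‖ :=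
    Finset.sum_nonneg fun i _ => by positivity
  calc ‖∑ i : Idx (d + 1) n, stc (d + 1) n a m2 i * φ (stp n z i)‖ ^ 2
      ≤ (∑ i : Idx (d + 1) n, ‖φ (stp n z i)‖ * ‖stc (d + 1) n a m2 i‖) ^ 2 := pow_le_pow_left₀ (norm_nonneg _) h1 2
    _ ≤ (∑ i : Idx (d + 1) n, ‖φ (stp n z i)‖ ^ 2) * C := h2

/-- **THE OPERATOR OF (2.44) IS BOUNDED BELOW ON `ℓ²(ξℤ^{d+1})`**: `‖(−Δ^ξ + m² + aQ_j^*Q_j)φ‖_{ℓ²} ≥ (min{8,a} + m²)‖φ‖_{ℓ²}`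
for every square-summable `φ`, `a ≥ 0`, `m² ≥ 0` — (1.8) and Cauchy–Schwarz; in particular the operator is injective with a
closed range, the quantitative form of «this bound justifies the definition (1.6)» for `Ω = ξℤ^{d+1}`, `A = 0`.
[cite: Balaban1983RegularityDecay, (1.8) p.573, (2.27)–(2.28) p.580; repaired constant; dictionary (Ω = ξℤ^{d+1}, A = 0)] -/
theorem norm_opD_ge (n : ℕ) [NeZero n] {a m2 : ℝ} (ha : 0 ≤ a) (hm : 0 ≤ m2) {φ : (Fin (d + 1) → ℤ) → ℂ}
    (hφ : Summable fun z => ‖φ z‖ ^ 2) :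
    (min 8 a + m2) * Real.sqrt (∑' z, ‖φ z‖ ^ 2) ≤ Real.sqrt (∑' z, ‖opD n a m2 φ z‖ ^ 2) := by
  set S : ℝ := ∑' z, ‖φ z‖ ^ 2 with hS
  set SD : ℝ := ∑' z, ‖opD n a m2 φ z‖ ^ 2 with hSD
  have hS0 : 0 ≤ S := tsum_nonneg fun z => sq_nonneg _
  have h1 := energy_lower_bound_l2 n ha hm hφ
  have h2 := re_tsum_conj_mul_le hφ (summable_normSq_opD n a m2 hφ)
  have h3 : (min 8 a + m2) * S ≤ Real.sqrt S * Real.sqrt SD := h1.trans h2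
  by_cases hz : Real.sqrt S = 0
  · rw [hz, mul_zero]; exact Real.sqrt_nonneg _
  · have hpos : 0 < Real.sqrt S := lt_of_le_of_ne (Real.sqrt_nonneg _) (Ne.symm hz)
    have h4 : (min 8 a + m2) * (Real.sqrt S * Real.sqrt S) ≤ Real.sqrt S * Real.sqrt SD := by
      rwa [Real.mul_self_sqrt hS0]
    have h5 : Real.sqrt S * ((min 8 a + m2) * Real.sqrt S) ≤ Real.sqrt S * Real.sqrt SD := by
      calc Real.sqrt S * ((min 8 a + m2) * Real.sqrt S) = (min 8 a + m2) * (Real.sqrt S * Real.sqrt S) := by ring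
        _ ≤ _ := h4
    exact le_of_mul_le_mul_left h5 hpos

/-- **INJECTIVITY WITH A MODULUS**: two `ℓ²` fields whose images under `−Δ^ξ + m² + aQ_j^*Q_j` coincide are equal whenever
`min{8,a} + m² > 0` (no dimension hypothesis; compare `B4Eq244L2Unique.opD_injective_l2`, which needs none of `a`, `m²`
positive but `d ≥ 1`). [cite: Balaban1983RegularityDecay, (1.8) p.573, (2.44) p.584; dictionary (Ω = ξℤ^{d+1}, A = 0)] -/
theorem opD_injective_l2_of_pos (n : ℕ) [NeZero n] {a m2 : ℝ} (ha : 0 ≤ a) (hm : 0 ≤ m2) (hγ : 0 < min 8 a + m2)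
    {φ₁ φ₂ : (Fin (d + 1) → ℤ) → ℂ} (h₁ : Summable fun z => ‖φ₁ z‖ ^ 2) (h₂ : Summable fun z => ‖φ₂ z‖ ^ 2)
    (h : ∀ z, opD n a m2 φ₁ z = opD n a m2 φ₂ z) : φ₁ = φ₂ := by
  have hdiff : Summable fun z => ‖(φ₁ - φ₂) z‖ ^ 2 := by
    refine Summable.of_nonneg_of_le (fun z => sq_nonneg _) (fun z => ?_) ((h₁.add h₂).mul_left 2)
    have := norm_sub_le (φ₁ z) (φ₂ z)
    simp only [Pi.sub_apply]
    nlinarith [norm_nonneg (φ₁ z - φ₂ z), norm_nonneg (φ₁ z), norm_nonneg (φ₂ z), sq_nonneg (‖φ₁ z‖ - ‖φ₂ z‖)]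
  have hb := norm_opD_ge n ha hm hdiff
  have h0 : ∀ z, opD n a m2 (φ₁ - φ₂) z = 0 := fun z => by rw [opD_sub, h z, sub_self]
  simp_rw [h0, norm_zero] at hb
  rw [zero_pow two_ne_zero, tsum_zero, Real.sqrt_zero] at hb
  have hs : Real.sqrt (∑' z, ‖(φ₁ - φ₂) z‖ ^ 2) = 0 := by
    have := Real.sqrt_nonneg (∑' z, ‖(φ₁ - φ₂) z‖ ^ 2)
    nlinarith
  have hs' : ∑' z, ‖(φ₁ - φ₂) z‖ ^ 2 = 0 := by
    rwa [Real.sqrt_eq_zero (tsum_nonneg fun z => sq_nonneg _)] at hs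
  have hz : ∀ z, ‖(φ₁ - φ₂) z‖ ^ 2 = 0 := by
    intro z
    have hle := hdiff.le_tsum z fun w _ => sq_nonneg _   -- careful with the signature
    rw [hs'] at hle
    exact le_antisymm hle (sq_nonneg _)
  funext z
  have := hz z
  rw [sq_eq_zero_iff, norm_eq_zero, Pi.sub_apply, sub_eq_zero] at this
  exact this

end

end Literature.MathematicalPhysics.QuantumFieldTheory.Balaban1983to89.B4Ineq227LatticeL2
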